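import Summits.KontsevichZagierPeriods.KontsevichZagierPeriods.Theorems.SoloBlindTwelveSporadicPullback
import Summits.KontsevichZagierPeriods.KontsevichZagierPeriods.Theorems.SoloBlindTriplication
import HarnessLib

/-!
# The sporadic class at level 12 inside the Kontsevich–Zagier rules

At level `N = 12` the Deligne–Koblitz–Ogus classification of algebraic relations between Beta
values has, besides the classes generated by the standard relations used so far in this
programme (reflection, Gauss multiplication, the `S₃`-symmetry of `B(a,b)B(a+b,c)`), exactly one
*sporadic* coincidence of the first kind: the three `Γ`-monomial classes

  `{2,3,7} ∋ B(1/6,1/4)`,  `{1,2,9} ∋ B(1/12,1/6)`,  `{2,2,8} ∋ B(1/6,1/6)`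

have algebraically proportional values although no chain of the standard two-term moves joins
`{2,3,7}` to the other two.

This file proves the proportionality *inside the Kontsevich–Zagier rules* (in the quotient `Q`
of formal integral representations by the three KZ moves, with scalars extended to `K₀ = ℚ̄ ∩ ℝ`):

* `betaQ_twelve_sporadic`:
  `β(1/3,1/2) + β(1/3,1/6) = (C/2) • β(3/4,1/6) + (C w₀/2) • β(1/4,1/6)`,
  `C = √P₀`, `P₀ = √(2√3-3)`, `w₀ = (2+√3)P₀` — a genuinely *three-term* identity, obtained from
  ONE integral `∫₀¹ η` by (i) splitting at `P₀` and substituting the degree-3 cover `t = F(W)` on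
  `(0,P₀)` and its companion `t = τ(W)` on `(P₀,1)` (`SoloBlindTwelveSporadicPrep/Pullback`), and
  (ii) substituting `s = W²` termwise;
* `betaQ_propTo_twelve_sporadic`: `β(1/6,1/4) ≐ β(1/6,1/6)` (a nonzero `K₀`-multiple), by
  combining the three-term identity with duplication (`β(1/6,1/6) ≐ β(1/6,1/2)`), triplication
  (`β(1/6,1/2) ≐ β(1/3,1/6) + β(1/3,1/2)`, `β(1/12,3/4) ≐ β(1/6,1/4) + β(1/6,7/12)`) and the orbit
  relations, with all coefficients explicit and of known sign so that no cancellation can occur.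

Together with `SoloBlindTetra` (the other sporadic coincidence of the first kind at level 12,
`{3,4,5} ~ {1,3,8} ~ {3,3,6}`), both first-kind Deligne–Koblitz–Ogus coincidences at level 12
that are not consequences of the Gauss multiplication formulas are now realised by KZ moves.

References: P. Deligne, *Valeurs de fonctions L et périodes d'intégrales*, appendix by
N. Koblitz and A. Ogus, Proc. Symp. Pure Math. 33 (1979) 313–346; M. Kontsevich, D. Zagier,
*Periods* (2001), §1.2; J. Ayoub, *Une version relative de la conjecture des périodes de
Kontsevich–Zagier*, Ann. of Math. 181 (2015) (for the formal period ring).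
-/

noncomputable section

open Set MeasureTheory MvPolynomial

namespace Summit.KontsevichZagierPeriods.KontsevichZagierPeriods.Theorems

namespace SoloBlind

open Literature.ModelTheory.ExponentialFields (IsSemialgebraic)
open Literature.NumberTheory.Transcendental
open Literature.NumberTheory.Transcendental.KZ

/-! ## The representations -/

/-- `[(0,1), η]`. -/
def spEtaRep : IntegralRep 1 :=
  lineRep (Ioo 0 1) spEta mix_line_sa sa_spEta_unit integrableOn_spEta

/-- `[(0,P₀), η]`. -/
def spEtaL : IntegralRep 1 :=
  lineRep (Ioo 0 sP0) spEta sp_lineL_sa sa_spEta_left integrableOn_spEta_left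

/-- `[(P₀,1), η]`. -/
def spEtaR : IntegralRep 1 :=
  lineRep (Ioo sP0 1) spEta sp_lineR_sa sa_spEta_right integrableOn_spEta_right

/-- `[(0,1), g₊]`. -/
def spGpRep : IntegralRep 1 := lineRep (Ioo 0 1) spGp mix_line_sa sa_spGp integrableOn_spGp

/-- `[(0,1), g₀]`. -/
def spG0Rep : IntegralRep 1 := lineRep (Ioo 0 1) spG0 mix_line_sa sa_spG0 integrableOn_spG0

/-! ## The coefficients `C/2` and `C w₀/2` in `K₀` -/

/-- `C/2 ∈ K₀`. -/
def spC1K : K₀ := spCK / 2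

/-- `C w₀/2 ∈ K₀`. -/
def spC2K : K₀ := spCK * sW0K / 2

/-- `((C/2 : K₀) : ℝ) = C/2`. -/
@[simp] theorem coe_spC1K : ((spC1K : K₀) : ℝ) = spC / 2 := by simp [spC1K]

/-- `((C w₀/2 : K₀) : ℝ) = C w₀/2`. -/
@[simp] theorem coe_spC2K : ((spC2K : K₀) : ℝ) = spC * sW0 / 2 := by simp [spC2K]

/-- `C/2` is algebraic. -/
theorem isAlgebraic_spC1 : IsAlgebraic ℚ (spC / 2) := isAlgebraic_of_K₀ spC1K coe_spC1K

/-- `C w₀/2` is algebraic. -/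
theorem isAlgebraic_spC2 : IsAlgebraic ℚ (spC * sW0 / 2) := isAlgebraic_of_K₀ spC2K coe_spC2K

/-! ## The moves -/

/-- **Move 1 (domain additivity):** `[(0,1), η] ≡ [(0,P₀), η] + [(P₀,1), η]` (the point `P₀` is
null). -/
theorem spEtaRep_split : of spEtaRep - (of spEtaL + of spEtaR) ∈ relations := by
  have hP := sP0_pos
  have hP1 := sP0_lt_one
  suffices h : of spEtaRep - ∑ i ∈ (Finset.univ : Finset (Fin 2)),
      of (![spEtaL, spEtaR] i) ∈ relations by
    rw [Fin.sum_univ_two, Matrix.cons_val_zero, Matrix.cons_val_one,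
      Matrix.cons_val_fin_one] at h
    exact h
  refine of_sub_sum_of_mem_relations (Finset.univ : Finset (Fin 2)) spEtaRep
    ![spEtaL, spEtaR] ?_ ?_ ?_ ?_
  · intro i _
    fin_cases i
    · refine measure_mono_null (fun x hx => ?_) measure_empty
      have h1 : x 0 ∈ Ioo (0:ℝ) sP0 := hx.1
      exact hx.2 (show x 0 ∈ Ioo (0:ℝ) 1 from ⟨h1.1, h1.2.trans hP1⟩)
    · refine measure_mono_null (fun x hx => ?_) measure_empty
      have h1 : x 0 ∈ Ioo sP0 1 := hx.1
      exact hx.2 (show x 0 ∈ Ioo (0:ℝ) 1 from ⟨hP.trans h1.1, h1.2⟩)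
  · intro i _
    fin_cases i <;> exact fun _ _ => rfl
  · have hnull : volume {x : Fin 1 → ℝ | x 0 = sP0} = 0 := by
      rw [volume_pi]
      exact Measure.pi_hyperplane (fun _ : Fin 1 => (volume : Measure ℝ)) 0 sP0
    refine measure_mono_null (fun x hx => ?_) hnull
    have h0 : x 0 ∈ Ioo (0:ℝ) 1 := hx.1
    have hn := hx.2
    simp only [Finset.mem_univ, iUnion_true, mem_iUnion, not_exists] at hn
    by_contra hc
    rcases lt_or_gt_of_ne hc with hlt | hgt
    · exact hn 0 (show x 0 ∈ Ioo (0:ℝ) sP0 from ⟨h0.1, hlt⟩)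
    · exact hn 1 (show x 0 ∈ Ioo sP0 1 from ⟨hgt, h0.2⟩)
  · intro i _ j _ hij
    refine measure_mono_null (fun x hx => ?_) measure_empty
    fin_cases i <;> fin_cases j
    · exact (hij rfl).elim
    · have h1 : x 0 ∈ Ioo (0:ℝ) sP0 := hx.1
      have h2 : x 0 ∈ Ioo sP0 1 := hx.2
      exact (lt_irrefl _ (h1.2.trans h2.1)).elim
    · have h1 : x 0 ∈ Ioo sP0 1 := hx.1
      have h2 : x 0 ∈ Ioo (0:ℝ) sP0 := hx.2
      exact (lt_irrefl _ (h2.2.trans h1.1)).elim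
    · exact (hij rfl).elim

/-- **Move 2 (substitution `t = F(W)` on `(0,P₀)`):** `[(0,P₀), η] ≡ β(1/3,1/2)`. -/
theorem spEtaL_sub_betaRep :
    of spEtaL - of (betaRep (1 / 3) (1 / 2) (by norm_num) (by norm_num)) ∈ relations := by
  unfold spEtaL betaRep
  exact lineRep_subst spF spF' sa_spF
    (fun W hW => (hasDerivAt_spF (spF_den_pos hW.1 (hW.2.trans sP0_lt_one)).ne').hasDerivWithinAt)
    injOn_spF image_spF (fun W hW => sp_pullF hW)

/-- **Move 3 (substitution `t = τ(W)` on `(P₀,1)`):** `[(P₀,1), η] ≡ β(1/3,1/6)`. -/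
theorem spEtaR_sub_betaRep :
    of spEtaR - of (betaRep (1 / 3) (1 / 6) (by norm_num) (by norm_num)) ∈ relations := by
  unfold spEtaR betaRep
  exact lineRep_subst spT spT' sa_spT
    (fun W hW => (hasDerivAt_spT (spT_den_pos (sP0_pos.trans hW.1) hW.2).ne').hasDerivWithinAt)
    injOn_spT image_spT (fun W hW => sp_pullT hW)

/-- **Move 4 (integrand additivity):** `[(0,1), η] ≡ (C/2)·[(0,1), g₊] + (C w₀/2)·[(0,1), g₀]`. -/
theorem spEtaRep_sub_sub :
    of spEtaRep - of (spGpRep.constMul (spC / 2) isAlgebraic_spC1) -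
      of (spG0Rep.constMul (spC * sW0 / 2) isAlgebraic_spC2) ∈ relations :=
  of_sub_sub_mem_relations_of_add rfl rfl fun v _ => by
    simp only [spEtaRep, spGpRep, spG0Rep, lineRep_integrand, IntegralRep.integrand_constMul]
    exact spEta_eq_add (v 0)

/-- **Move 5 (substitution `s = W²`):** `[(0,1), g₊] ≡ β(3/4,1/6)`. -/
theorem spGpRep_sub_betaRep :
    of spGpRep - of (betaRep (3 / 4) (1 / 6) (by norm_num) (by norm_num)) ∈ relations := by
  unfold spGpRep betaRep
  exact lineRep_subst (fun W => W ^ 2) (fun W => 2 * W)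
    ((isSemialgebraicFunOn_aeval mix_line_sa (X 0 ^ 2 : MvPolynomial (Fin 1) ℚ)).congr
      fun x _ => by simp)
    (fun u _ => (hasDerivAt_sq u).hasDerivWithinAt) injOn_sq_unit image_sq_unit
    (fun W hW => sp_sqGp hW)

/-- **Move 6 (substitution `s = W²`):** `[(0,1), g₀] ≡ β(1/4,1/6)`. -/
theorem spG0Rep_sub_betaRep :
    of spG0Rep - of (betaRep (1 / 4) (1 / 6) (by norm_num) (by norm_num)) ∈ relations := by
  unfold spG0Rep betaRep
  exact lineRep_subst (fun W => W ^ 2) (fun W => 2 * W)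
    ((isSemialgebraicFunOn_aeval mix_line_sa (X 0 ^ 2 : MvPolynomial (Fin 1) ℚ)).congr
      fun x _ => by simp)
    (fun u _ => (hasDerivAt_sq u).hasDerivWithinAt) injOn_sq_unit image_sq_unit
    (fun W hW => sp_sqG0 hW)

/-! ## In `Q` -/

/-- `[(0,P₀), η] = β(1/3,1/2)` in `Q`. -/
theorem spEtaL_eq : mkQ (of spEtaL) = betaQ (1 / 3) (1 / 2) := by
  rw [betaQ_eq (by norm_num) (by norm_num)]
  exact mkQ_eq_mkQ_iff.mpr spEtaL_sub_betaRep

/-- `[(P₀,1), η] = β(1/3,1/6)` in `Q`. -/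
theorem spEtaR_eq : mkQ (of spEtaR) = betaQ (1 / 3) (1 / 6) := by
  rw [betaQ_eq (by norm_num) (by norm_num)]
  exact mkQ_eq_mkQ_iff.mpr spEtaR_sub_betaRep

/-- `[(0,1), g₊] = β(3/4,1/6)` in `Q`. -/
theorem spGpRep_eq : mkQ (of spGpRep) = betaQ (3 / 4) (1 / 6) := by
  rw [betaQ_eq (by norm_num) (by norm_num)]
  exact mkQ_eq_mkQ_iff.mpr spGpRep_sub_betaRep

/-- `[(0,1), g₀] = β(1/4,1/6)` in `Q`. -/
theorem spG0Rep_eq : mkQ (of spG0Rep) = betaQ (1 / 4) (1 / 6) := by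
  rw [betaQ_eq (by norm_num) (by norm_num)]
  exact mkQ_eq_mkQ_iff.mpr spG0Rep_sub_betaRep

/-- **The sporadic three-term relation at level 12, inside the Kontsevich–Zagier rules:**
`β(1/3,1/2) + β(1/3,1/6) = (C/2) • β(3/4,1/6) + (C w₀/2) • β(1/4,1/6)`. -/
theorem betaQ_twelve_sporadic :
    betaQ (1 / 3) (1 / 2) + betaQ (1 / 3) (1 / 6) =
      spC1K • betaQ (3 / 4) (1 / 6) + spC2K • betaQ (1 / 4) (1 / 6) := by
  have h1 : mkQ (of spEtaRep) = mkQ (of spEtaL) + mkQ (of spEtaR) := by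
    rw [← map_add, mkQ_eq_mkQ_iff]
    exact spEtaRep_split
  have h2 : mkQ (of spEtaRep) = mkQ (of (spGpRep.constMul (spC / 2) isAlgebraic_spC1)) +
      mkQ (of (spG0Rep.constMul (spC * sW0 / 2) isAlgebraic_spC2)) := by
    rw [← map_add, mkQ_eq_mkQ_iff]
    have h := spEtaRep_sub_sub
    rwa [sub_sub] at h
  have hGp : mkQ (of (spGpRep.constMul (spC / 2) isAlgebraic_spC1)) =
      spC1K • betaQ (3 / 4) (1 / 6) := by
    rw [mkQ_constMul, spGpRep_eq]
    exact congrArg (· • betaQ (3 / 4) (1 / 6)) (Subtype.ext (by simp))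
  have hG0 : mkQ (of (spG0Rep.constMul (spC * sW0 / 2) isAlgebraic_spC2)) =
      spC2K • betaQ (1 / 4) (1 / 6) := by
    rw [mkQ_constMul, spG0Rep_eq]
    exact congrArg (· • betaQ (1 / 4) (1 / 6)) (Subtype.ext (by simp))
  rw [← spEtaL_eq, ← spEtaR_eq, ← h1, h2, hGp, hG0]

/-- Period check: `B(1/3,1/2) + B(1/3,1/6) = (C/2) B(3/4,1/6) + (C w₀/2) B(1/4,1/6)`
(numerically both sides are `12.6196389479…`). -/
theorem beta_twelve_sporadic_value :
    evalQ (betaQ (1 / 3) (1 / 2)) + evalQ (betaQ (1 / 3) (1 / 6)) =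
      spC / 2 * evalQ (betaQ (3 / 4) (1 / 6)) + spC * sW0 / 2 * evalQ (betaQ (1 / 4) (1 / 6)) := by
  have h := congrArg evalQ betaQ_twelve_sporadic
  rwa [map_add, map_add, evalQ_smul, evalQ_smul, coe_spC1K, coe_spC2K] at h

/-! ## Signs of the coefficients -/

/-- `0 < sin(πa)` for `0 < a < 1` (as a real number). -/
theorem sinQ_coe_pos {a : ℚ} (h0 : 0 < a) (h1 : a < 1) : 0 < (sinQ a : ℝ) := by
  rw [sinQ_val]
  have ha : (0 : ℝ) < a := by exact_mod_cast h0
  have ha1 : (a : ℝ) < 1 := by exact_mod_cast h1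
  exact Real.sin_pos_of_pos_of_lt_pi (mul_pos Real.pi_pos ha) (by nlinarith [Real.pi_pos])

/-- `0 < 3^{b-1}`. -/
theorem coe_triCoeff_pos (b : ℚ) : 0 < ((triCoeff b : K₀) : ℝ) := by
  rw [coe_triCoeff]
  exact Real.rpow_pos_of_pos (by norm_num) _

/-- `0 < 2·4^{-a}`. -/
theorem coe_duplCoeff_pos (a : ℚ) : 0 < ((duplCoeff a : K₀) : ℝ) := by
  rw [coe_duplCoeff]
  exact mul_pos two_pos (Real.rpow_pos_of_pos (by norm_num) _)

/-- An element of `K₀` with positive real value is nonzero. -/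
theorem K₀_ne_zero_of_pos {c : K₀} (h : 0 < (c : ℝ)) : c ≠ 0 := fun e =>
  h.ne' (by rw [e]; rfl)

/-! ## The merge -/

/-- **The sporadic merge at level 12: `β(1/6,1/4) ≐ β(1/6,1/6)`** — the `Γ`-class `{2,3,7}`
meets `{2,2,8}` (and hence `{1,2,9}`) inside the Kontsevich–Zagier rules.  Precisely
`M • β(1/6,1/4) = D • β(1/6,1/6)` with
`D = sin(π/6) sin(7π/12)` and
`M = 2·4^{-1/6}·3^{-1/2}·((C/2)·sin(π/12)·3^{-1/4}·(sin(7π/12) + sin(π/4)) + (C w₀/2)·D)`,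
both positive. -/
theorem betaQ_propTo_twelve_sporadic : PropTo (betaQ (1 / 6) (1 / 4)) (betaQ (1 / 6) (1 / 6)) := by
  have hd : betaQ (1 / 6) (1 / 6) = duplCoeff (1 / 6) • betaQ (1 / 6) (1 / 2) :=
    betaQ_dupl (1 / 6) (by norm_num)
  have ht : betaQ (1 / 6) (1 / 2) =
      triCoeff (1 / 2) • (betaQ (1 / 3) (1 / 6) + betaQ (1 / 3) (1 / 2)) := by
    have h := betaQ_tripl0 (1 / 6) (1 / 2) (by norm_num) (by norm_num) (by norm_num)
    norm_num at h
    simpa only [smul_add] using h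
  have key := betaQ_twelve_sporadic
  have h1 : sinQ (1 / 12) • betaQ (1 / 12) (3 / 4) = sinQ (1 / 6) • betaQ (3 / 4) (1 / 6) := by
    have h := orbit_pair (3 / 4) (1 / 6) (1 / 12) (by norm_num) (by norm_num) (by norm_num)
      (by norm_num)
    rwa [betaQ_symm (show (0:ℚ) < 3 / 4 by norm_num) (show (0:ℚ) < 1 / 12 by norm_num)] at h
  have h3 : betaQ (1 / 12) (3 / 4) =
      triCoeff (3 / 4) • (betaQ (1 / 6) (1 / 4) + betaQ (1 / 6) (7 / 12)) := by
    have h := betaQ_tripl0 (1 / 12) (3 / 4) (by norm_num) (by norm_num) (by norm_num)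
    norm_num at h
    simpa only [smul_add] using h
  have h4 : sinQ (7 / 12) • betaQ (1 / 6) (7 / 12) = sinQ (1 / 4) • betaQ (1 / 6) (1 / 4) :=
    orbit_pair (1 / 6) (1 / 4) (7 / 12) (by norm_num) (by norm_num) (by norm_num) (by norm_num)
  have hs : betaQ (1 / 4) (1 / 6) = betaQ (1 / 6) (1 / 4) :=
    betaQ_symm (show (0:ℚ) < 1 / 4 by norm_num) (show (0:ℚ) < 1 / 6 by norm_num)
  -- signs
  have hs6 := sinQ_coe_pos (show (0:ℚ) < 1 / 6 by norm_num) (by norm_num)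
  have hs12 := sinQ_coe_pos (show (0:ℚ) < 1 / 12 by norm_num) (by norm_num)
  have hs712 := sinQ_coe_pos (show (0:ℚ) < 7 / 12 by norm_num) (by norm_num)
  have hs4 := sinQ_coe_pos (show (0:ℚ) < 1 / 4 by norm_num) (by norm_num)
  have hdC := coe_duplCoeff_pos (1 / 6)
  have ht2 := coe_triCoeff_pos (1 / 2)
  have ht34 := coe_triCoeff_pos (3 / 4)
  have hc1 : (0:ℝ) < spC / 2 := by linarith [spC_pos]
  have hc2 : (0:ℝ) < spC * sW0 / 2 := by nlinarith [spC_pos, sW0_pos]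
  have hD : sinQ (1 / 6) * sinQ (7 / 12) ≠ 0 :=
    K₀_ne_zero_of_pos (by push_cast; exact mul_pos hs6 hs712)
  have hM : duplCoeff (1 / 6) * triCoeff (1 / 2) *
      (spC1K * (sinQ (1 / 12) * triCoeff (3 / 4) * (sinQ (7 / 12) + sinQ (1 / 4))) +
        spC2K * (sinQ (1 / 6) * sinQ (7 / 12))) ≠ 0 := by
    refine K₀_ne_zero_of_pos ?_
    push_cast [coe_spC1K, coe_spC2K]
    exact mul_pos (mul_pos hdC ht2) (add_pos (mul_pos hc1 (mul_pos (mul_pos hs12 ht34)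
      (add_pos hs712 hs4))) (mul_pos hc2 (mul_pos hs6 hs712)))
  refine PropTo.of_smul_eq_smul hM hD ?_
  linear_combination (norm := module)
    (-(sinQ (1 / 6) * sinQ (7 / 12))) • hd
    - (sinQ (1 / 6) * sinQ (7 / 12) * duplCoeff (1 / 6)) • ht
    - (sinQ (1 / 6) * sinQ (7 / 12) * duplCoeff (1 / 6) * triCoeff (1 / 2)) • key
    + (duplCoeff (1 / 6) * triCoeff (1 / 2) * spC1K * sinQ (7 / 12)) • h1
    - (duplCoeff (1 / 6) * triCoeff (1 / 2) * spC1K * sinQ (7 / 12) * sinQ (1 / 12)) • h3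
    - (duplCoeff (1 / 6) * triCoeff (1 / 2) * spC1K * sinQ (1 / 12) * triCoeff (3 / 4)) • h4
    - (sinQ (1 / 6) * sinQ (7 / 12) * duplCoeff (1 / 6) * triCoeff (1 / 2) * spC2K) • hs

/-- The merge read in the other direction: `β(1/6,1/6) ≐ β(1/6,1/4)`. -/
theorem betaQ_propTo_twelve_sporadic' : PropTo (betaQ (1 / 6) (1 / 6)) (betaQ (1 / 6) (1 / 4)) :=
  betaQ_propTo_twelve_sporadic.symm

end SoloBlind

end Summit.KontsevichZagierPeriods.KontsevichZagierPeriods.Theorems
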